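import Literature.Computability.Complexity.UmansFPWalk
import Literature.Computability.Complexity.UmansFPDecodeFP
import Literature.Computability.Complexity.UmansFPPredictor
import HarnessLib

/-!
# Umans' generator, machine level XII: the walk runs in polynomial time (`CodeFP`)

Literature / circuit complexity — derandomization. Machine side of `UmansFPWalk.lean`: with the
predictor program `predLT gd` (`UmansFPPredictor.lean`) and the automorphism `u ↦ lsqIter c pc u kσ`
(`UmansFPExtField.lean`), the level loop, the phase, the walk and the reconstruction are computed
on codes by polynomial-time string functions. The two loops go through `CodeFP.foldl`, whose
accumulator bounds are UNCONDITIONAL: every table appended by a level is a `learnL` table (`q` rows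
of `d` entries below `2ᵂ`, `learnL_shape`), and every window of a walk state is clamped
(`clampTab_shape`).

* `WPrm` (the data tuple `(gd, (pars, n₀), bn, ((pc, kσ), (q', P, T)))`), `runLevelT`, `phaseT`,
  `walkT`, `reconstructT`;
* `sigTabC`, `clampTabC`, `lastWinLC`, **`runLevelTC`**, **`phaseTC`**, **`walkTC`**, **`reconstructTC`**.

Everything is proved; no named fact.

## References

* C. Umans, *Pseudo-random generators for all hardnesses*, JCSS 67 (2003), §6.3 [Umans2003].
* S. Arora, B. Barak, *Computational Complexity: A Modern Approach*, CUP 2009, §1.3 [AroraBarak2009].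
-/

noncomputable section

namespace Literature.Computability.Complexity

open Polynomial Literature.InformationTheory.Coding
open Literature.InformationTheory.Coding.GF2X CodeFP

namespace UmansFP

/-! ### The data tuple and the tuple forms of the programs -/

/-- The parameters of one step without the predictor data: `(((c, q, I, J), (D, A, cap), d), n₀)`. [folklore] -/
abbrev SPars : Type := (((ℕ × ℕ × ℕ) × ℕ × ℕ × ℕ) × (ℕ × ℕ × ℕ) × ℕ) × ℕ

/-- **The data of the walk**: `(gd, (pars, n₀), bn, ((pc, kσ), (q', P, T)))`. [folklore] -/
abbrev WPrm : Type := GDat × SPars × List (List ℕ) × ((List ℕ × ℕ) × (ℕ × ℕ × ℕ))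

namespace WPrm

variable (p : WPrm)

/-- the field context -/ abbrev c : ℕ × ℕ × ℕ := p.2.1.1.1.1
/-- `q` -/ abbrev q : ℕ := p.2.1.1.1.2.1
/-- `I` -/ abbrev I : ℕ := p.2.1.1.1.2.2.1
/-- `J` -/ abbrev J : ℕ := p.2.1.1.1.2.2.2
/-- `D` -/ abbrev D : ℕ := p.2.1.1.2.1.1
/-- `A` -/ abbrev A : ℕ := p.2.1.1.2.1.2.1
/-- `cap` -/ abbrev cap : ℕ := p.2.1.1.2.1.2.2
/-- `d` -/ abbrev d : ℕ := p.2.1.1.2.2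
/-- `n₀` -/ abbrev n₀ : ℕ := p.2.1.2
/-- the node lists -/ abbrev bn : List (List ℕ) := p.2.2.1
/-- the modulus coefficients of `L` -/ abbrev pc : List ℕ := p.2.2.2.1.1
/-- the number of squarings of `σ` -/ abbrev kσ : ℕ := p.2.2.2.1.2
/-- `q'` -/ abbrev q' : ℕ := p.2.2.2.2.1
/-- `P` -/ abbrev P : ℕ := p.2.2.2.2.2.1
/-- `T` -/ abbrev T : ℕ := p.2.2.2.2.2.2

end WPrm

/-- The automorphism program of the data. [folklore] -/
def sLOf (p : WPrm) (u : List ℕ) : List ℕ := lsqIter p.c p.pc u p.kσ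

/-- The level loop as a function of `(p, cl, init)`. [folklore] -/
def runLevelT (t : WPrm × ℕ × List (Tab × Tab)) : List (Tab × Tab) :=
  runLevelL t.1.c t.1.q t.1.I t.1.J t.1.D t.1.A t.1.cap t.1.d t.1.n₀ (predLT t.1.1) t.1.bn t.2.1 t.2.2 t.1.T

/-- The phase as a function of `(p, (cl, w), st)`. [folklore] -/
def phaseT (t : WPrm × (ℕ × ℕ) × WStateL) : WStateL :=
  phaseL t.1.c t.1.q t.1.I t.1.J t.1.D t.1.A t.1.cap t.1.d t.1.n₀ (predLT t.1.1) t.1.bn (sLOf t.1) t.1.q' t.1.P t.1.T t.2.1.1 t.2.1.2 t.2.2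

/-- The walk as a function of `(p, digits, st₀)`. [folklore] -/
def walkT (t : WPrm × List ℕ × WStateL) : ℕ × WStateL :=
  walkL t.1.c t.1.q t.1.I t.1.J t.1.D t.1.A t.1.cap t.1.d t.1.n₀ (predLT t.1.1) t.1.bn (sLOf t.1) t.1.q' t.1.P t.1.T t.2.1 t.2.2

/-- The reconstruction as a function of `(p, digits, st₀)`. [folklore] -/
def reconstructT (t : WPrm × List ℕ × WStateL) : List ℕ :=
  reconstructL t.1.c t.1.q t.1.I t.1.J t.1.D t.1.A t.1.cap t.1.d t.1.n₀ (predLT t.1.1) t.1.bn (sLOf t.1) t.1.q' t.1.P t.1.T t.2.1 t.2.2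

/-! ### Unconditional shapes -/

/-- A table of at most `q` rows of at most `B` entries, each at most `2ᵂ`. [folklore] -/
def TabShape (W B q : ℕ) (T : Tab) : Prop := T.length ≤ q ∧ ∀ r ∈ T, r.length ≤ B ∧ ∀ x ∈ r, x ≤ 2 ^ W

/-- `learnL` tables have the shape `(W, d, q)`. [folklore] -/
theorem learnL_shape (c : ℕ × ℕ × ℕ) (q I J D A cap d : ℕ) (gL : List (List ℕ) → List (List ℕ)) (Ws : List Tab) (nodes : List ℕ)
    (knownLs : List (List ℕ)) : TabShape c.1 d q (learnL c q I J D A cap d gL Ws nodes knownLs) := by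
  refine ⟨(length_learnL ..).le, fun r hr => ?_⟩
  rw [learnL] at hr
  obtain ⟨b, -, rfl⟩ := List.mem_map.1 hr
  refine ⟨by rw [List.length_map, List.length_map, List.length_range], fun x hx => ?_⟩
  obtain ⟨f, -, rfl⟩ := List.mem_map.1 hx
  rw [keval]
  exact foldl_keval_le c b _ 0 (Nat.zero_le _)

/-- Clamped tables have the shape `(W, B, q)`. [folklore] -/
theorem clampTab_shape (W B q : ℕ) (T : Tab) : TabShape W B q (clampTab W B q T) := by
  refine ⟨by rw [clampTab, List.length_map, List.length_take]; exact min_le_left _ _, fun r hr => ?_⟩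
  obtain ⟨r', -, rfl⟩ := List.mem_map.1 hr
  refine ⟨by rw [List.length_map, List.length_take]; exact min_le_left _ _, fun x hx => ?_⟩
  obtain ⟨x', -, rfl⟩ := List.mem_map.1 hx
  exact min_le_right _ _

/-- The code of a shaped table. [folklore] -/
theorem length_code_tabShape {W B q : ℕ} {T : Tab} (h : TabShape W B q T) : (rawE (rawE natE) T).length ≤ q * (2 * (B * (2 * W + 4)) + 2) :=
  length_code_rows_le h.1 (fun r hr => (h.2 r hr).1) (fun r hr x hx => (h.2 r hr).2 x hx)

/-- Along the level loop: the list is the initial one followed by `stepL` pairs. [folklore] -/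
theorem runLevel_fold_shape (c : ℕ × ℕ × ℕ) (q I J D A cap d n₀ : ℕ) (gL : List (List ℕ) → List (List ℕ)) (bn : List (List ℕ)) (cl : ℕ)
    (init : List (Tab × Tab)) (u : List Unit) :
    ∃ tail : List (Tab × Tab), u.foldl (fun l (_ : Unit) =>
        l ++ [stepL c q I J D A cap d n₀ gL (bn.getD (d - cl) []) (bn.getD 0 []) (lastWinL n₀ l).1 (lastWinL n₀ l).2]) init = init ++ tail ∧
      tail.length = u.length ∧ ∀ p ∈ tail, TabShape c.1 d q p.1 ∧ TabShape c.1 d q p.2 := by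
  induction u using List.reverseRecOn with
  | nil => exact ⟨[], by simp, rfl, fun p hp => by simp at hp⟩
  | append_singleton u x ih =>
    obtain ⟨tail, htail, hlen, hsh⟩ := ih
    refine ⟨tail ++ [stepL c q I J D A cap d n₀ gL (bn.getD (d - cl) []) (bn.getD 0 []) (lastWinL n₀ (init ++ tail)).1 (lastWinL n₀ (init ++ tail)).2],
      ?_, by rw [List.length_append, List.length_append, hlen]; rfl, fun p hp => ?_⟩
    · rw [List.foldl_append, List.foldl_cons, List.foldl_nil, htail, List.append_assoc]
    · rw [List.mem_append, List.mem_singleton] at hp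
      rcases hp with hp | rfl
      · exact hsh p hp
      · exact ⟨learnL_shape .., learnL_shape ..⟩

/-! ### `CodeFP` certificates -/

section Machine

/-- The code of coefficient lists. -/
local notation "L" => rawE natE
/-- The code of tables. -/
local notation "matE" => rawE (rawE natE)
/-- The code of table pairs. -/
local notation "ptE" => pairE (rawE (rawE natE)) (rawE (rawE natE))
/-- The code of lists of table pairs. -/
local notation "lstE" => rawE (pairE (rawE (rawE natE)) (rawE (rawE natE)))
/-- The code of walk states. -/
local notation "stE" => pairE natE (pairE (rawE (rawE (rawE natE))) (rawE (rawE (rawE natE))))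

/-- The code of `SPars`. [folklore] -/
abbrev sparsE : SPars → List Bool := pairE (pairE (pairE kctxE (pairE unE (pairE unE unE))) (pairE (pairE unE (pairE natE unE)) unE)) unE

/-- The code of `WPrm`. [folklore] -/
abbrev wprmE : WPrm → List Bool := pairE gdE (pairE sparsE (pairE (rawE (rawE natE)) (pairE (pairE (rawE natE) unE) (pairE natE (pairE natE unE)))))

/-- **`σ` on a table on codes**: `(p, T) ↦ sigTab (sLOf p) T`. [folklore] -/
theorem sigTabC : CodeFP (pairE wprmE matE) matE (fun t => sigTab (sLOf t.1) t.2) := by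
  have hc : CodeFP (pairE wprmE L) kctxE (fun t => t.1.c) := (fst _ _).snd'.fst'.fst'.fst'.fst'
  have hpc : CodeFP (pairE wprmE L) L (fun t => t.1.pc) := (fst _ _).snd'.snd'.snd'.fst'.fst'
  have hk : CodeFP (pairE wprmE L) unE (fun t => t.1.kσ) := (fst _ _).snd'.snd'.snd'.fst'.snd'
  have hs : CodeFP (pairE wprmE L) L (fun t => lsqIter t.1.c t.1.pc t.2 t.1.kσ) := (lsqIterFP.comp (hc.pair (hpc.pair ((snd _ _).pair hk))) :)
  exact ((map hs).congr fun _ => rfl)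

/-- **Clamping on codes**: `((1ᵂ, 1ᴮ, 1^q), T) ↦ clampTab W B q T`. [folklore] -/
theorem clampTabC : CodeFP (pairE (pairE unE (pairE unE unE)) matE) matE (fun t => clampTab t.1.1 t.1.2.1 t.1.2.2 t.2) := by
  -- entry map: item `x`, context `2ᵂ`
  have hx : CodeFP (pairE natE natE) natE (fun t => min t.2 t.1) := natMin.comp ((snd _ _).pair (fst _ _))
  -- row map: item `r`, context `(2ᵂ, B)`
  have hr : CodeFP (pairE (pairE natE unE) L) L (fun t => (t.2.take t.1.2).map fun x => min x t.1.1) :=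
    ((map hx).comp ((fst _ _).fst'.pair ((rawTakeNat natE).comp ((natOfUn.comp (fst _ _).snd').pair (snd _ _)))) :)
  have hctx : CodeFP (pairE (pairE unE (pairE unE unE)) matE) (pairE natE unE) (fun t => (2 ^ t.1.1, t.1.2.1)) :=
    (natPow.comp ((const _ 2).pair (fst _ _).fst')).pair (fst _ _).snd'.fst'
  have htake : CodeFP (pairE (pairE unE (pairE unE unE)) matE) matE (fun t => t.2.take t.1.2.2) :=
    (rawTakeNat L).comp ((natOfUn.comp (fst _ _).snd'.snd').pair (snd _ _))
  exact (((map hr).comp (hctx.pair htake)).congr fun _ => rfl)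

/-- **The last windows on codes**: `(1^{n₀}, l) ↦ lastWinL n₀ l`. [folklore] -/
theorem lastWinLC : CodeFP (pairE unE lstE) (pairE (rawE matE) (rawE matE)) (fun t => lastWinL t.1 t.2) := by
  have hlen : CodeFP (pairE unE lstE) unE (fun t => t.2.length) := (ulength ptE).comp (snd _ _)
  have hk : CodeFP (pairE unE lstE) unE (fun t => min (t.2.length - t.1) t.2.length) :=
    unOfNatMin.comp (hlen.pair (natSub.comp ((natOfUn.comp hlen).pair (natOfUn.comp (fst _ _)))))
  have hdrop : CodeFP (pairE unE lstE) lstE (fun t => t.2.drop (min (t.2.length - t.1) t.2.length)) := (rawDropUn ptE).comp (hk.pair (snd _ _))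
  refine ((((map₀ (fst matE matE)).comp hdrop).pair ((map₀ (snd matE matE)).comp hdrop)).congr fun t => ?_)
  simp only [lastWinL, min_eq_left (Nat.sub_le _ _)]

/-- **The level loop on codes**: `(p, 1^{cl}, init) ↦ runLevelT (p, cl, init)`.
[cite: Umans2003, §6.3; AroraBarak2009, §1.3] -/
theorem runLevelTC : CodeFP (pairE wprmE (pairE unE lstE)) lstE runLevelT := by
  -- context `σ = (p, cl, init)`, items `()`, state `l`
  let σE : WPrm × ℕ × List (Tab × Tab) → List Bool := pairE wprmE (pairE unE lstE)
  have hp : CodeFP (pairE σE (pairE unitE lstE)) wprmE (fun t => t.1.1) := (fst _ _).fst'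
  have hcl : CodeFP (pairE σE (pairE unitE lstE)) unE (fun t => t.1.2.1) := (fst _ _).snd'.fst'
  have hl : CodeFP (pairE σE (pairE unitE lstE)) lstE (fun t => t.2.2) := (snd _ _).snd'
  have hgd : CodeFP (pairE σE (pairE unitE lstE)) gdE (fun t => t.1.1.1) := hp.fst'
  have hsp : CodeFP (pairE σE (pairE unitE lstE)) sparsE (fun t => t.1.1.2.1) := hp.snd'.fst'
  have hbn : CodeFP (pairE σE (pairE unitE lstE)) matE (fun t => t.1.1.bn) := hp.snd'.snd'.fst'
  have hd : CodeFP (pairE σE (pairE unitE lstE)) unE (fun t => t.1.1.d) := hsp.fst'.snd'.snd'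
  have hn0 : CodeFP (pairE σE (pairE unitE lstE)) unE (fun t => t.1.1.n₀) := hsp.snd'
  have hb1 : CodeFP (pairE σE (pairE unitE lstE)) L (fun t => t.1.1.bn.getD (t.1.1.d - t.1.2.1) []) :=
    ((rawGetD L (d := ([] : List ℕ)) rfl).comp (hbn.pair (natSub.comp ((natOfUn.comp hd).pair (natOfUn.comp hcl)))) :)
  have hb0 : CodeFP (pairE σE (pairE unitE lstE)) L (fun t => t.1.1.bn.getD 0 []) :=
    ((rawGetD L (d := ([] : List ℕ)) rfl).comp (hbn.pair (const _ 0)) :)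
  have hlw : CodeFP (pairE σE (pairE unitE lstE)) (pairE (rawE matE) (rawE matE)) (fun t => lastWinL t.1.1.n₀ t.2.2) := (lastWinLC.comp (hn0.pair hl) :)
  have htuple := hgd.pair (hsp.pair ((hb1.pair hb0).pair hlw))
  have hstep' := (stepLC (G := GDat) (eG := gdE) (gL := predLT) predLTC).comp htuple
  have hstep : CodeFP (pairE σE (pairE unitE lstE)) lstE (fun t => t.2.2 ++ [stepT predLT (t.1.1.1, t.1.1.2.1,
      (t.1.1.bn.getD (t.1.1.d - t.1.2.1) [], t.1.1.bn.getD 0 []), lastWinL t.1.1.n₀ t.2.2)]) :=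
    ((rawAppend ptE).comp (hl.pair ((rawSingleton ptE).comp hstep')) :)
  have h := foldl (σ := WPrm × ℕ × List (Tab × Tab)) (eσ := σE) (eα := unitE) (eβ := lstE)
    (step := fun (s : WPrm × ℕ × List (Tab × Tab)) (_ : Unit) (l : List (Tab × Tab)) =>
      l ++ [stepT predLT (s.1.1, s.1.2.1, (s.1.bn.getD (s.1.d - s.2.1) [], s.1.bn.getD 0 []), lastWinL s.1.n₀ l)])
    (init := fun s => s.2.2) hstep (snd _ _).snd' (100 * (X + 1) ^ 4)
    (fun s l₁ l₂ => by
      obtain ⟨p, cl, init⟩ := s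
      dsimp only
      set Lc := (pairE σE (rawE unitE) ((p, cl, init), l₁ ++ l₂)).length with hLc
      obtain ⟨tail, htail, hlen, hsh⟩ := runLevel_fold_shape p.c p.q p.I p.J p.D p.A p.cap p.d p.n₀ (predLT p.1) p.bn cl init l₁
      have htail' : l₁.foldl (fun l (_ : Unit) => l ++ [stepT predLT (p.1, p.2.1, (p.bn.getD (p.d - cl) [], p.bn.getD 0 []), lastWinL p.n₀ l)]) init =
          init ++ tail := htail
      rw [htail', rawE_append, List.length_append]
      -- sizes from the input
      have hWle : p.c.1 ≤ Lc := by
        rw [hLc]; simp only [σE, pairE_apply, length_boolPair, length_unE, WPrm.c]; omega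
      have hq : p.q ≤ Lc := by rw [hLc]; simp only [σE, pairE_apply, length_boolPair, length_unE, WPrm.q]; omega
      have hdd : p.d ≤ Lc := by rw [hLc]; simp only [σE, pairE_apply, length_boolPair, length_unE, WPrm.d]; omega
      have hinit : (rawE ptE init).length ≤ Lc := by rw [hLc]; simp only [σE, pairE_apply, length_boolPair]; omega
      have hl₁ : l₁.length ≤ Lc := by
        have := length_le_length_rawE unitE (l₁ ++ l₂); rw [List.length_append] at this
        rw [hLc]; simp only [σE, pairE_apply, length_boolPair]; omega
      -- each appended pair is short
      have htab : ∀ T : Tab, TabShape p.c.1 p.d p.q T → (rawE (rawE natE) T).length ≤ Lc * (2 * (Lc * (2 * Lc + 4)) + 2) := fun T hT =>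
        (length_code_tabShape hT).trans (Nat.mul_le_mul hq (by nlinarith [Nat.mul_le_mul hdd (show 2 * p.c.1 + 4 ≤ 2 * Lc + 4 by omega)]))
      have hitem : ∀ pp ∈ tail, (ptE pp).length ≤ 3 * (Lc * (2 * (Lc * (2 * Lc + 4)) + 2)) + 2 := fun pp hpp => by
        obtain ⟨s1, s2⟩ := hsh pp hpp
        rw [pairE_apply, length_boolPair]
        have := htab _ s1; have := htab _ s2; omega
      have htl := (length_rawE_le_of_forall hitem).trans (Nat.mul_le_mul_right _ (hlen.le.trans hl₁))
      simp only [eval_mul, eval_pow, eval_add, eval_X, eval_ofNat, eval_one]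
      nlinarith [Nat.zero_le Lc, Nat.zero_le (Lc * Lc), Nat.zero_le (Lc * Lc * Lc)])
  refine ((h.comp ((CodeFP.id _).pair (replicateUnit.comp (fst _ _).snd'.snd'.snd'.snd'.snd'.snd'))).congr fun t => ?_)
  rfl

/-- **The phase on codes**: `(p, (1^{cl}, w), st) ↦ phaseT (p, (cl, w), st)`. [cite: Umans2003, §6.3; AroraBarak2009, §1.3] -/
theorem phaseTC : CodeFP (pairE wprmE (pairE (pairE unE natE) stE)) stE phaseT := by
  let τE : WPrm × (ℕ × ℕ) × WStateL → List Bool := pairE wprmE (pairE (pairE unE natE) stE)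
  have hp : CodeFP τE wprmE (fun t => t.1) := fst _ _
  have hcl : CodeFP τE unE (fun t => t.2.1.1) := (snd _ _).fst'.fst'
  have hw : CodeFP τE natE (fun t => t.2.1.2) := (snd _ _).fst'.snd'
  have ha : CodeFP τE natE (fun t => t.2.2.1) := (snd _ _).snd'.fst'
  have hW1 : CodeFP τE (rawE matE) (fun t => t.2.2.2.1) := (snd _ _).snd'.snd'.fst'
  have hW2 : CodeFP τE (rawE matE) (fun t => t.2.2.2.2) := (snd _ _).snd'.snd'.snd'
  have hsp : CodeFP τE sparsE (fun t => t.1.2.1) := hp.snd'.fst'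
  have hq : CodeFP τE unE (fun t => t.1.q) := hsp.fst'.fst'.snd'.fst'
  have hd : CodeFP τE unE (fun t => t.1.d) := hsp.fst'.snd'.snd'
  have hWd : CodeFP τE unE (fun t => t.1.c.1) := hsp.fst'.fst'.fst'.fst'
  have hn0 : CodeFP τE unE (fun t => t.1.n₀) := hsp.snd'
  have hq' : CodeFP τE natE (fun t => t.1.q') := hp.snd'.snd'.snd'.snd'.fst'
  have hP : CodeFP τE natE (fun t => t.1.P) := hp.snd'.snd'.snd'.snd'.snd'.fst'
  -- the level
  have hl : CodeFP τE lstE (fun t => runLevelT (t.1, t.2.1.1, List.zip t.2.2.2.1 t.2.2.2.2)) :=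
    (runLevelTC.comp (hp.pair (hcl.pair ((rawZip matE matE).comp (hW1.pair hW2)))) :)
  -- the new base
  have hbase : CodeFP τE natE (fun t => (t.2.2.1 + t.2.1.2) * t.1.q' % t.1.P) := (natMod.comp ((natMul.comp ((natAdd.comp (ha.pair hw)).pair hq')).pair hP) :)
  -- the new windows: item `k`, context `(t, l)`
  let κE := pairE (pairE τE lstE) natE
  have kidx : CodeFP κE natE (fun s => s.1.1.2.1.2 + (s.2 + 1) * s.1.1.1.q - 1) :=
    (natSub.comp ((natAdd.comp ((hw.comp (fst _ _).fst').pair (natMul.comp ((natAdd.comp ((snd _ _).pair (const _ 1))).pair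
      (natOfUn.comp (hq.comp (fst _ _).fst')))))).pair (const _ 1)) :)
  have kget : CodeFP κE ptE (fun s => s.1.2.getD (s.1.1.2.1.2 + (s.2 + 1) * s.1.1.1.q - 1) (([] : Tab), ([] : Tab))) :=
    ((rawGetOr ptE).comp ((fst _ _).snd'.pair (kidx.pair (const _ ((([] : Tab), ([] : Tab)))))) :)
  have kclamp : ∀ {g : (((WPrm × (ℕ × ℕ) × WStateL) × List (Tab × Tab)) × ℕ) → Tab}, CodeFP κE matE g →
      CodeFP κE matE (fun s => clampTab s.1.1.1.c.1 s.1.1.1.d s.1.1.1.q (sigTab (sLOf s.1.1.1) (g s))) := fun hg =>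
    (clampTabC.comp ((((hWd.comp (fst _ _).fst')).pair ((hd.comp (fst _ _).fst').pair (hq.comp (fst _ _).fst'))).pair
      (sigTabC.comp ((hp.comp (fst _ _).fst').pair hg))) :)
  have hwin1 := (map (kclamp kget.fst')).comp (((CodeFP.id _).pair hl).pair (urange.comp hn0))
  have hwin2 := (map (kclamp kget.snd')).comp (((CodeFP.id _).pair hl).pair (urange.comp hn0))
  refine ((hbase.pair (hwin1.pair hwin2)).congr fun t => ?_)
  rfl

/-- Sizes along the walk: the level counter is the number of digits read, the base grows by a
bounded number of bits per phase, and the windows are the initial ones or `n₀` clamped tables each.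
[folklore] -/
theorem walk_fold_shape (p : WPrm) (st₀ : WStateL) {S : ℕ} :
    ∀ l₁ : List ℕ, (∀ w ∈ l₁, Nat.size w ≤ S) →
      let r := l₁.foldl (fun cst w => (cst.1 + 1, phaseL p.c p.q p.I p.J p.D p.A p.cap p.d p.n₀ (predLT p.1) p.bn (sLOf p) p.q' p.P p.T cst.1 w cst.2)) (0, st₀)
      r.1 = l₁.length ∧ Nat.size r.2.1 ≤ Nat.size st₀.1 + l₁.length * (S + Nat.size p.q' + 1) ∧
        (r.2.2 = st₀.2 ∨ ((r.2.2.1.length = p.n₀ ∧ ∀ T ∈ r.2.2.1, TabShape p.c.1 p.d p.q T) ∧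
          (r.2.2.2.length = p.n₀ ∧ ∀ T ∈ r.2.2.2, TabShape p.c.1 p.d p.q T))) := by
  intro l₁
  induction l₁ using List.reverseRecOn with
  | nil => intro _; exact ⟨rfl, by simp, Or.inl rfl⟩
  | append_singleton l w ih =>
    intro hS
    obtain ⟨h1, h2, -⟩ := ih fun x hx => hS x (List.mem_append_left _ hx)
    have hw := hS w (List.mem_append_right _ (List.mem_singleton_self w))
    simp only [List.foldl_append, List.foldl_cons, List.foldl_nil, List.length_append, List.length_singleton]
    set r := l.foldl (fun cst w => (cst.1 + 1, phaseL p.c p.q p.I p.J p.D p.A p.cap p.d p.n₀ (predLT p.1) p.bn (sLOf p) p.q' p.P p.T cst.1 w cst.2)) (0, st₀)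
    refine ⟨by rw [h1], ?_, Or.inr ⟨⟨?_, fun T hT => ?_⟩, ⟨?_, fun T hT => ?_⟩⟩⟩
    · show Nat.size (((r.2.1 + w) * p.q') % p.P) ≤ _
      have e1 : Nat.size (((r.2.1 + w) * p.q') % p.P) ≤ Nat.size ((r.2.1 + w) * p.q') := Nat.size_le_size (Nat.mod_le _ _)
      have e2 := CodeFP.size_mul_le (r.2.1 + w) p.q'
      have e3 : Nat.size (r.2.1 + w) ≤ Nat.size r.2.1 + Nat.size w + 1 :=
        (CodeFP.size_add_le _ _).trans (by omega)
      have e4 : (l.length + 1) * (S + p.q'.size + 1) = l.length * (S + p.q'.size + 1) + (S + p.q'.size + 1) := by ring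
      rw [e4]
      omega
    · show ((List.range p.n₀).map _).length = _; rw [List.length_map, List.length_range]
    · obtain ⟨k, -, rfl⟩ := List.mem_map.1 hT; exact clampTab_shape ..
    · show ((List.range p.n₀).map _).length = _; rw [List.length_map, List.length_range]
    · obtain ⟨k, -, rfl⟩ := List.mem_map.1 hT; exact clampTab_shape ..

/-- **The walk on codes**: `(p, digits, st₀) ↦ walkT (p, digits, st₀)` (a fold over the digits whose
state stays polynomial: `walk_fold_shape`). [cite: Umans2003, §6.3; AroraBarak2009, §1.3] -/
theorem walkTC : CodeFP (pairE wprmE (pairE (rawE natE) stE)) (pairE unE stE) walkT := by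
  -- context `σ = (p, st₀)`, items the digits, state `(cnt, st)`
  let σE : WPrm × WStateL → List Bool := pairE wprmE stE
  have hstep : CodeFP (pairE σE (pairE natE (pairE unE stE))) (pairE unE stE)
      (fun t => (t.2.2.1 + 1, phaseT (t.1.1, (t.2.2.1, t.2.1), t.2.2.2))) :=
    ((unSucc.comp (snd _ _).snd'.fst').pair (phaseTC.comp ((fst _ _).fst'.pair ((((snd _ _).snd'.fst').pair (snd _ _).fst').pair
      (snd _ _).snd'.snd'))) :)
  have hinit : CodeFP σE (pairE unE stE) (fun s => ((0 : ℕ), s.2)) := ((const _ 0).pair (snd _ _) :)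
  have h := foldl (σ := WPrm × WStateL) (eσ := σE) (eα := natE) (eβ := pairE unE stE)
    (step := fun (s : WPrm × WStateL) (w : ℕ) (cst : ℕ × WStateL) => (cst.1 + 1, phaseT (s.1, (cst.1, w), cst.2)))
    (init := fun s => (0, s.2)) hstep hinit (200 * (X + 1) ^ 4) (fun s l₁ l₂ => by
      obtain ⟨p, st₀⟩ := s
      dsimp only
      set Lc := (pairE σE (rawE natE) ((p, st₀), l₁ ++ l₂)).length with hLc
      have hS : ∀ w ∈ l₁, Nat.size w ≤ Lc := fun w hw => by
        have e1 := length_item_le_length_rawE natE (List.mem_append_left l₂ hw)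
        rw [length_natE] at e1
        have e2 : (rawE natE (l₁ ++ l₂)).length ≤ Lc := by
          show _ ≤ (boolPair (σE (p, st₀)) (rawE natE (l₁ ++ l₂))).length
          rw [length_boolPair]; omega
        omega
      obtain ⟨h1, h2, h3⟩ := walk_fold_shape p st₀ l₁ hS
      set r := l₁.foldl (fun cst w => (cst.1 + 1, phaseL p.c p.q p.I p.J p.D p.A p.cap p.d p.n₀ (predLT p.1) p.bn (sLOf p) p.q' p.P p.T cst.1 w cst.2)) (0, st₀)
        with hr
      have hr' : l₁.foldl (fun (cst : ℕ × WStateL) (w : ℕ) => (cst.1 + 1, phaseT (p, (cst.1, w), cst.2))) (0, st₀) = r := rfl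
      rw [hr']
      obtain ⟨gd, ⟨⟨⟨⟨c, q, I, J⟩, ⟨D, A, cap⟩, d⟩, n0⟩, bn, ⟨pc, kσ⟩, q', P, T⟩⟩ := p
      obtain ⟨a₀, W1, W2⟩ := st₀
      -- sizes from the input
      have hW : c.1 ≤ Lc := by
        obtain ⟨Wc, f, Pm⟩ := c
        rw [hLc]; simp only [σE, pairE_apply, length_boolPair, length_unE]; omega
      have hq : q ≤ Lc := by rw [hLc]; simp only [σE, pairE_apply, length_boolPair, length_unE]; omega
      have hd : d ≤ Lc := by rw [hLc]; simp only [σE, pairE_apply, length_boolPair, length_unE]; omega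
      have hn0 : n0 ≤ Lc := by rw [hLc]; simp only [σE, pairE_apply, length_boolPair, length_unE]; omega
      have hq' : (natE q').length ≤ Lc := by rw [hLc]; simp only [σE, pairE_apply, length_boolPair, length_unE]; omega
      have ha₀ : (natE a₀).length ≤ Lc := by rw [hLc]; simp only [σE, pairE_apply, length_boolPair, length_unE]; omega
      have hW1 : (rawE matE W1).length ≤ Lc := by rw [hLc]; simp only [σE, pairE_apply, length_boolPair, length_unE]; omega
      have hW2 : (rawE matE W2).length ≤ Lc := by rw [hLc]; simp only [σE, pairE_apply, length_boolPair, length_unE]; omega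
      have hl₁ : l₁.length ≤ Lc := by
        have := length_le_length_rawE natE (l₁ ++ l₂); rw [List.length_append] at this
        rw [hLc]; simp only [σE, pairE_apply, length_boolPair]; omega
      -- the state
      simp only [WPrm.c, WPrm.q, WPrm.d, WPrm.n₀, WPrm.q'] at h1 h2 h3
      have hcnt : (unE r.1).length ≤ Lc := by rw [length_unE, h1]; exact hl₁
      have hbase : (natE r.2.1).length ≤ Lc + Lc * (Lc + Lc + 1) := by
        rw [length_natE]
        refine h2.trans (Nat.add_le_add (by rw [← length_natE]; exact ha₀) (Nat.mul_le_mul hl₁ ?_))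
        rw [← length_natE]; omega
      have htab : ∀ Tb : Tab, TabShape c.1 d q Tb → (rawE (rawE natE) Tb).length ≤ Lc * (2 * (Lc * (2 * Lc + 4)) + 2) := fun Tb hT =>
        (length_code_tabShape hT).trans (Nat.mul_le_mul hq (by nlinarith [Nat.mul_le_mul hd (show 2 * c.1 + 4 ≤ 2 * Lc + 4 by omega)]))
      have hwin : ∀ Ws : List Tab, (Ws.length = n0 ∧ ∀ Tb ∈ Ws, TabShape c.1 d q Tb) →
          (rawE matE Ws).length ≤ Lc * (2 * (Lc * (2 * (Lc * (2 * Lc + 4)) + 2)) + 2) := fun Ws hWs =>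
        (length_rawE_le_of_forall fun Tb hTb => htab Tb (hWs.2 Tb hTb)).trans (Nat.mul_le_mul_right _ (hWs.1.le.trans hn0))
      have hwins : (rawE matE r.2.2.1).length ≤ Lc + Lc * (2 * (Lc * (2 * (Lc * (2 * Lc + 4)) + 2)) + 2) ∧
          (rawE matE r.2.2.2).length ≤ Lc + Lc * (2 * (Lc * (2 * (Lc * (2 * Lc + 4)) + 2)) + 2) := by
        rcases h3 with h3 | ⟨h31, h32⟩
        · rw [h3]; exact ⟨hW1.trans (Nat.le_add_right _ _), hW2.trans (Nat.le_add_right _ _)⟩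
        · exact ⟨(hwin _ h31).trans (Nat.le_add_left _ _), (hwin _ h32).trans (Nat.le_add_left _ _)⟩
      simp only [pairE_apply, length_boolPair, eval_mul, eval_pow, eval_add, eval_X, eval_ofNat, eval_one]
      nlinarith [hwins.1, hwins.2, Nat.zero_le Lc, Nat.zero_le (Lc * Lc), Nat.zero_le (Lc * Lc * Lc), Nat.zero_le (Lc * Lc * Lc * Lc)])
  exact ((h.comp (((fst _ _).pair (snd _ _).snd').pair (snd _ _).fst')).congr fun _ => rfl)

/-- **The reconstruction on codes**: `(p, digits, st₀) ↦ reconstructT (p, digits, st₀)`. [cite: Umans2003, §6.3] -/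
theorem reconstructTC : CodeFP (pairE wprmE (pairE (rawE natE) stE)) L reconstructT :=
  (((rawGetD L (d := ([] : List ℕ)) rfl).comp ((((rawGetD matE (d := ([] : Tab)) rfl).comp
    (walkTC.snd'.snd'.fst'.pair (const _ 0)))).pair (const _ 0))).congr fun _ => rfl)

end Machine

end UmansFP

end Literature.Computability.Complexity

end
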